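import Mathlib.Analysis.Complex.Schwarz
import Literature.MathematicalPhysics.QuantumFieldTheory.Balaban1983to89.B13Lemma3TorusTerms
import Summits.QuantumFields.BalabanUV.T4Continuum.Spine.NE1p.DressedOutputAnalytic

/-!
# Spine/NE5/TwoRunTorusParam — the torus chain's OUTPUT is holomorphic in ANY complex parameter of the (2.14)-term
# families, with the (2.41) bound uniform: the joint (background seam, two-run pencil) statement for rows (D4) and NE5
# on the papers' periodic carrier (cell `pub-balaban-gaps`, seat `ne5` gen 7)

WHY.  `TwoRunTorusRate.norm_E_sub_le_torus` is the PENCIL case (parameter space `ℂ`, two end members) of a statement that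
row (D4)'s NODE A consumes in the SEAM direction (parameter = the complex background seam of [II] p. 15; cf. an4's
`RemainderStepAdapterHolo.StepObjectD4`, whose inputs are the activity-holomorphy leaf and `Lemma3OnH`) and that
gen 3 typed at the ACTIVITY layer on abstract objects (`Spine/NE5/StepObjectFromActivities`, NE5 ⟹ D4).  Here it is ON
THE CARRIER, from the (2.26) layer: for a family of (2.14)-term families `b ↦ P Z t φ b` over an open set `V` of any complex
normed space `B`, holomorphic in `b` and obeying (2.26) UNIFORMLY on `V`, Lemma 3's restrictions give (2.38) for every
member (`bound238_torus_param`), and with (2.13) per member, the space restriction and the (2.39)–(2.41) numbers the output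
`b ↦ E^b(X)(φ)` is complex differentiable on `V` with `‖E^b(X)(φ)‖ ≤ A₂C₃ε₁e^{−(1−10δ)½Lκd_{k+1}(X)}` uniformly
(`differentiableOn_E_torus_param` — ne1's parametric [KP86] engine `NE1p.DressedOutputAnalytic.analytic_and_bounded_locE_param`
over r10's `TreeLengthTorusGeometry.tgeometry 4 N′`; cf. the torus END `NE1p.DressedOutputAnalyticFaces.analytic_and_bounded_locE_param_torus`
of ne1's crew, same engine and constants).  `B = ℂ`, `V = ball 0 ρ` and Schwarz (`TwoRunTorusRate.norm_sub_le_of_pencil`, p366187)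
recover the two-run rate `TwoRunTorusRate.norm_E_sub_le_torus`; `B = ℂ × B′`, `V = ball 0 ρ ×ˢ W` is the JOINT (pencil,
seam) family of `TwoRunPencilWalks.jointWalkExpansion_pencilParam` read at the output.  (This file does not import
`TwoRunTorusRate`; the two are siblings over the same tree inputs.)

HONEST FRAMING.  Bookkeeping + complex analysis over LANDED shapes; the family `P`, its parameter set and every constant are
HYPOTHESES; nothing of Bałaban's is constructed or asserted; (D4) NOT discharged (instance 0∕1); NE5 NOT PRINTED ∕ NOT
PROVED; leaves 0∕12; spine 0∕9.  Rung (B)+1 on a FIXED finite T⁴ — NOT continuum, NOT infinite volume, NOT mass gap, NOT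
Clay.  HONEST DEPENDENCY: continuum YM on T⁴ ⇐ BetaPertH ∧ nine spine estimates; BetaPertH ⇐ (D1) ∧ (D4) ∧ CAP+tail.
0 sorry, 0 `def`.

Sources: [II] = T. Bałaban, CMP **116** (1988) [Balaban1988RG2Cluster] (2.13)–(2.14) pp. 14–15, p. 15 (analyticity in
(𝐔, 𝐉)), (2.26) p. 17, (2.38) p. 20, (2.41) p. 21; R. Kotecký, D. Preiss, CMP **103** (1986) [KoteckyPreiss1986].  Nothing
here is a claim about the Yang–Mills mass gap.
-/

noncomputable section

namespace Summit.QuantumFields.BalabanUV.T4Continuum.Spine.NE5.TwoRunTorusParam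

open Metric Set Finset
open Literature.MathematicalPhysics.QuantumFieldTheory.Balaban1983to89
open Literature.MathematicalPhysics.QuantumFieldTheory.Balaban1983to89.TreeLengthTorus (TPt TDom tsys)
open Literature.MathematicalPhysics.QuantumFieldTheory.Balaban1983to89.TreeLengthTorusGeometry
  (TTouch tgeometry tgeometry_consts_four)
open Literature.MathematicalPhysics.QuantumFieldTheory.Balaban1983to89.B13Lemma3TorusData (TBond)
open Literature.MathematicalPhysics.QuantumFieldTheory.Balaban1983to89.B13Lemma3Torus (TwoTorusStep)
open Literature.MathematicalPhysics.QuantumFieldTheory.Balaban1983to89.B13Lemma3TorusTerms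
  (terms weight bound238_torus_of_226)
open Literature.MathematicalPhysics.QuantumFieldTheory.Balaban1983to89.B12TreeDecay (kappa₀ K₀)
open Literature.MathematicalPhysics.QuantumFieldTheory.Balaban1983to89.B13Resummation (locE locE_congr)
open Summit.QuantumFields.BalabanUV.T4Continuum.NE1p.DressedOutputAnalytic (analytic_and_bounded_locE_param)

variable {L N' : ℕ} [NeZero L] [NeZero N'] {M : ℕ} [NeZero M]
variable {B : Type*}

/-- **(2.38) FOR EVERY MEMBER OF A PARAMETRISED FAMILY on the torus model** (any parameter set `V`): (2.26) uniform on
`V` for the term families `b ↦ P Z t φ b` + Lemma 3's numerical restrictions (verbatim those of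
`B13Lemma3TorusTerms.bound238_torus_of_226`) ⇒ `‖Σ_{t ∈ terms Z} P Z t φ b‖ ≤ C₃ε₁e^{−(1−8δ)½Lκd_{k+1}(Z)}` on `sp2 Z` for
every `b ∈ V`.  (`TwoRunTorusRate.bound238_torus_pencil` is `V = ball 0 ρ ⊆ ℂ`.) [cite: Balaban1988RG2Cluster, Lemma 3 (2.38) p.20, (2.26) p.17] -/
theorem bound238_torus_param (c : B13.Consts) (hL : 8 ≤ c.L) (hLc : c.L = L) (W : TwoTorusStep 4 L N')
    (P : (Z : TDom 4 N') → Finset (TDom 4 (L * N')) × Finset (TBond 4 M (L * N')) → W.Φ → B → ℂ)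
    {V : Set B} {a a₂ a₂' a₅ Aabs : ℝ}
    (h226 : ∀ b ∈ V, ∀ (Z : TDom 4 N') (φ : W.Φ), φ ∈ W.sp2 Z → ∀ t ∈ terms L M Z,
      ‖P Z t φ b‖ ≤ weight L M c Z a t * Real.exp (a₅ * ((Z.1).card : ℝ)))
    (hα₆ : 0 < c.α₆) (hε₀ : 0 ≤ c.eps2) (hδ : 0 ≤ c.δ) (hδ7 : 0 ≤ 1 - 7 * c.δ) (hκ : 0 ≤ c.κ) (ha : 0 ≤ a)
    (hR15 : c.R15) (hR16 : 18 * ((1 - 4 * c.δ) * c.κ) ≤ a / 20) (hR16' : 4 * c.κ ≤ a / 20)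
    (hR17 : Real.exp (-(a / 20)) ≤ c.eps2) (h231 : 2 * (4 : ℝ) * (M : ℝ) ^ 4 * Real.exp (-(a / 10)) ≤ a / 20)
    (ha₂ : 0 ≤ a₂) (hκ229 : kappa₀ 64 8 + a₂ ≤ c.δ * c.κ)
    (hsm229 : c.α₆ * Real.exp a₂ * K₀ 64 8 * 64 ≤ a₂)
    (habsk : Real.exp (-(a / 20)) * 64 ≤ c.δ * c.κ)
    (h18half : B13Step237.R18half c (K₀ 64 8 * Real.exp (Real.exp (-(a / 20)) * 64)))
    (h18 : B13Step237.R18sharp c (K₀ 64 8 * Real.exp (Real.exp (-(a / 20)) * 64)) ((c.L : ℝ) / 2))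
    (ha₂' : 0 ≤ a₂') (hκ229' : kappa₀ 64 8 + a₂' ≤ c.δ * ((c.L : ℝ) / 2) * c.κ)
    (hsm229' : c.α₆ * Real.exp a₂' * K₀ 64 8 * 64 ≤ a₂')
    (hR20 : 18 * ((1 - 7 * c.δ) * ((c.L : ℝ) / 2) * c.κ) ≤ (c.κ₁ - 1) / 2)
    (ha₅ : 0 ≤ a₅) (habs : a₅ + Real.exp (-((c.κ₁ - 1) / 2)) ≤ Aabs)
    (hAc : Aabs * 64 ≤ c.δ * ((c.L : ℝ) / 2) * c.κ)
    (hC3 : B13Step237.bracketF c (K₀ 64 8 * Real.exp (Real.exp (-(a / 20)) * 64)) / c.α₆ *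
      Real.exp (Aabs * 64) ≤ c.C3act * c.ε₁) :
    ∀ b ∈ V, ∀ (Z : TDom 4 N') (φ : W.Φ), φ ∈ W.sp2 Z →
      ‖∑ t ∈ terms L M Z, P Z t φ b‖ ≤
        c.C3act * c.ε₁ * Real.exp (-((1 - 8 * c.δ) * ((c.L : ℝ) / 2) * c.κ * (tsys 4 N').dj Z)) := by
  intro b hb Z φ hφ
  have h := bound238_torus_of_226 c hL hLc { W with H := fun Z φ => ∑ t ∈ terms L M Z, P Z t φ b }
    (fun Z t φ => P Z t φ b) (fun Z φ _ => norm_sum_le _ _) (fun Z φ hφ t ht => h226 b hb Z φ hφ t ht)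
    hα₆ hε₀ hδ hδ7 hκ ha hR15 hR16 hR16' hR17 h231 ha₂ hκ229 hsm229 habsk h18half h18 ha₂' hκ229' hsm229' hR20 ha₅
    habs hAc hC3
  exact h Z φ hφ

open Classical in
/-- **THE OUTPUT IS HOLOMORPHIC IN THE PARAMETER, WITH THE (2.41) BOUND UNIFORM** (torus model; the joint statement for
rows (D4) — seam direction — and NE5 — pencil direction).  For a family of (2.14)-term families `b ↦ P Z t φ b` on an
OPEN set `V` of a complex normed space `B`: each `b ↦ P Z t φ b` complex differentiable on `V` (`hPhol`), (2.26) uniform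
on `V` (`h226`), Lemma 3's restrictions, the activities `H^b(Z) = Σ_t P Z t φ b` and outputs `E^b(X) = locE(H^b)(X)`
((2.13) over the torus incompatibility `TTouch`) for `b ∈ V` on the spaces, the space restriction p. 15, and the
(2.39)–(2.41) numbers at the torus constants (ν = 9, c₁ = 64, K₀(64, 8), κ₀ = 64 log 162; `r₁ = (1−10δ)½Lκ`).  Then for
every `X` and `φ ∈ sp2 X`: `b ↦ E^b(X)(φ)` is complex differentiable on `V` and
`‖E^b(X)(φ)‖ ≤ A₂C₃ε₁·e^{−(1−10δ)½Lκd_{k+1}(X)}` for all `b ∈ V`.  (ne1's `analytic_and_bounded_locE_param` over r10's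
`tgeometry 4 N′`, fed by `bound238_torus_param` on `Z ⊆ X`; `locE_congr` + `DifferentiableOn.congr` read the family's
outputs.) [cite: Balaban1988RG2Cluster, p.15, (2.13) p.14, (2.38) p.20, (2.41) p.21; KoteckyPreiss1986, Thm 1] -/
theorem differentiableOn_E_torus_param [NormedAddCommGroup B] [NormedSpace ℂ B] (c : B13.Consts) (hL : 8 ≤ c.L)
    (hLc : c.L = L) (W : TwoTorusStep 4 L N')
    (P : (Z : TDom 4 N') → Finset (TDom 4 (L * N')) × Finset (TBond 4 M (L * N')) → W.Φ → B → ℂ)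
    {V : Set B} (hV : IsOpen V) {a a₂ a₂' a₅ Aabs : ℝ}
    (hPhol : ∀ (Z : TDom 4 N') (φ : W.Φ), φ ∈ W.sp2 Z → ∀ t ∈ terms L M Z,
      DifferentiableOn ℂ (P Z t φ) V)
    (h226 : ∀ b ∈ V, ∀ (Z : TDom 4 N') (φ : W.Φ), φ ∈ W.sp2 Z → ∀ t ∈ terms L M Z,
      ‖P Z t φ b‖ ≤ weight L M c Z a t * Real.exp (a₅ * ((Z.1).card : ℝ)))
    (hα₆ : 0 < c.α₆) (hε₀ : 0 ≤ c.eps2) (hδ : 0 ≤ c.δ) (hδ7 : 0 ≤ 1 - 7 * c.δ) (hκ : 0 ≤ c.κ) (ha : 0 ≤ a)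
    (hR15 : c.R15) (hR16 : 18 * ((1 - 4 * c.δ) * c.κ) ≤ a / 20) (hR16' : 4 * c.κ ≤ a / 20)
    (hR17 : Real.exp (-(a / 20)) ≤ c.eps2) (h231 : 2 * (4 : ℝ) * (M : ℝ) ^ 4 * Real.exp (-(a / 10)) ≤ a / 20)
    (ha₂ : 0 ≤ a₂) (hκ229 : kappa₀ 64 8 + a₂ ≤ c.δ * c.κ)
    (hsm229 : c.α₆ * Real.exp a₂ * K₀ 64 8 * 64 ≤ a₂)
    (habsk : Real.exp (-(a / 20)) * 64 ≤ c.δ * c.κ)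
    (h18half : B13Step237.R18half c (K₀ 64 8 * Real.exp (Real.exp (-(a / 20)) * 64)))
    (h18 : B13Step237.R18sharp c (K₀ 64 8 * Real.exp (Real.exp (-(a / 20)) * 64)) ((c.L : ℝ) / 2))
    (ha₂' : 0 ≤ a₂') (hκ229' : kappa₀ 64 8 + a₂' ≤ c.δ * ((c.L : ℝ) / 2) * c.κ)
    (hsm229' : c.α₆ * Real.exp a₂' * K₀ 64 8 * 64 ≤ a₂')
    (hR20 : 18 * ((1 - 7 * c.δ) * ((c.L : ℝ) / 2) * c.κ) ≤ (c.κ₁ - 1) / 2)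
    (ha₅ : 0 ≤ a₅) (habs : a₅ + Real.exp (-((c.κ₁ - 1) / 2)) ≤ Aabs)
    (hAc : Aabs * 64 ≤ c.δ * ((c.L : ℝ) / 2) * c.κ)
    (hC3 : B13Step237.bracketF c (K₀ 64 8 * Real.exp (Real.exp (-(a / 20)) * 64)) / c.α₆ *
      Real.exp (Aabs * 64) ≤ c.C3act * c.ε₁)
    {H : B → TDom 4 N' → W.Φ → ℂ}
    (hH : ∀ b ∈ V, ∀ (Z : TDom 4 N') (φ : W.Φ), φ ∈ W.sp2 Z → H b Z φ = ∑ t ∈ terms L M Z, P Z t φ b)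
    (hsp : ∀ X Z : TDom 4 N', ∀ φ, Z.1 ⊆ X.1 → φ ∈ W.sp2 X → φ ∈ W.sp2 Z)
    {E : B → TDom 4 N' → W.Φ → ℂ}
    (h213 : ∀ b ∈ V, ∀ (X : TDom 4 N') (φ : W.Φ), φ ∈ W.sp2 X →
      E b X φ = locE (TTouch (d := 4) (N := N')) (fun Z : TDom 4 N' => Z.1) (fun Z => H b Z φ) X.1)
    (hAct : 0 ≤ c.C3act * c.ε₁) (hr₁ : 0 ≤ (1 - 10 * c.δ) * ((c.L : ℝ) / 2) * c.κ)
    (hlarge : (1 - 10 * c.δ) * ((c.L : ℝ) / 2) * c.κ + 2 * (64 * Real.log 162) + 2 ≤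
      (1 - 8 * c.δ) * ((c.L : ℝ) / 2) * c.κ)
    (hsmall : c.C3act * c.ε₁ * Real.exp (5 * ((1 - 10 * c.δ) * ((c.L : ℝ) / 2) * c.κ) + 1) * K₀ 64 8 * 9 * 64 ≤ 1)
    (hA₂ : Real.exp 1 * 9 * 64 * K₀ 64 8 ^ 2 ≤ c.A₂) :
    ∀ (X : TDom 4 N') (φ : W.Φ), φ ∈ W.sp2 X →
      DifferentiableOn ℂ (fun b => E b X φ) V ∧
        ∀ b ∈ V, ‖E b X φ‖ ≤
          c.A₂ * c.C3act * c.ε₁ * Real.exp (-((1 - 10 * c.δ) * ((c.L : ℝ) / 2) * c.κ * (tsys 4 N').dj X)) := by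
  intro X φ hφ
  have h238 := bound238_torus_param c hL hLc W P h226 hα₆ hε₀ hδ hδ7 hκ ha hR15 hR16 hR16' hR17 h231 ha₂ hκ229
    hsm229 habsk h18half h18 ha₂' hκ229' hsm229' hR20 ha₅ habs hAc hC3
  set G := tgeometry 4 N' with hG
  haveI : Std.Refl (TTouch (d := 4) (N := N')) := ⟨G.ι_refl⟩
  haveI : Std.Symm (TTouch (d := 4) (N := N')) := ⟨G.ι_symm⟩
  have hGν : G.ν = 9 := (tgeometry_consts_four N').1
  have hGκ₀ : G.κ₀ = 64 * Real.log 162 := (tgeometry_consts_four N').2.1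
  have hGc₁ : G.c₁ = 64 := (tgeometry_consts_four N').2.2
  have hGK₀ : G.K₀ = K₀ 64 8 := by
    show K₀ (4 * 2 ^ 4) (2 * 4) = K₀ 64 8
    norm_num
  set act : B → TDom 4 N' → ℂ := fun b Z => ∑ t ∈ terms L M Z, P Z t φ b with hact
  have hhol : ∀ Z : TDom 4 N', Z.1 ⊆ X.1 → DifferentiableOn ℂ (fun b => act b Z) V :=
    fun Z hZ => DifferentiableOn.fun_sum fun t ht => hPhol Z φ (hsp X Z φ hZ hφ) t ht
  have hm : ∀ b ∈ V, ∀ Z : TDom 4 N', Z.1 ⊆ X.1 → ‖act b Z‖ ≤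
      c.C3act * c.ε₁ * Real.exp (-((1 - 8 * c.δ) * ((c.L : ℝ) / 2) * c.κ * (tsys 4 N').dj Z)) :=
    fun b hb Z hZ => h238 b hb Z φ (hsp X Z φ hZ hφ)
  obtain ⟨hdiff, hbd⟩ := analytic_and_bounded_locE_param (TTouch (d := 4) (N := N'))
    (cubes := fun Z : TDom 4 N' => Z.1) (reach := G.reach) (d := (tsys 4 N').dj)
    (m := fun Z => c.C3act * c.ε₁ * Real.exp (-((1 - 8 * c.δ) * ((c.L : ℝ) / 2) * c.κ * (tsys 4 N').dj Z)))
    (act := act) (A := c.C3act * c.ε₁) (R := (1 - 8 * c.δ) * ((c.L : ℝ) / 2) * c.κ)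
    (r₁ := (1 - 10 * c.δ) * ((c.L : ℝ) / 2) * c.κ) (κ₀ := G.κ₀) (K₀ := G.K₀) (c₁ := G.c₁) (c := 5)
    (b := 5 * ((1 - 10 * c.δ) * ((c.L : ℝ) / 2) * c.κ)) (ν := G.ν) (dX := (tsys 4 N').dj X) (X := X.1) hV G.loc
    G.reach_le (tsys 4 N').dj_nonneg hAct G.K₀_nonneg G.c₁_nonneg G.ν_nonneg G.κ₀_nonneg hr₁ (by norm_num)
    (le_of_eq (by ring)) G.ineq126 G.volBound (G.ineq227 X) (by rw [hGκ₀]; exact hlarge)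
    (by rw [hGK₀, hGν, hGc₁]; exact hsmall) (G.cubes_nonempty X) hhol hm (fun Z _ => le_rfl)
  -- read the family's outputs on `V`
  have hE : ∀ b ∈ V, locE (TTouch (d := 4) (N := N')) (fun Z : TDom 4 N' => Z.1) (act b) X.1 = E b X φ := by
    intro b hb
    rw [h213 b hb X φ hφ]
    exact locE_congr _ fun Z hZ => (hH b hb Z φ (hsp X Z φ hZ hφ)).symm
  refine ⟨hdiff.congr fun b hb => (hE b hb).symm, fun b hb => ?_⟩
  have key := hbd b hb
  rw [hGν, hGc₁, hGK₀] at key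
  set Ex := Real.exp (-((1 - 10 * c.δ) * ((c.L : ℝ) / 2) * c.κ * (tsys 4 N').dj X)) with hEx
  have hEx0 : 0 ≤ Ex := Real.exp_nonneg _
  calc ‖E b X φ‖ = ‖locE (TTouch (d := 4) (N := N')) (fun Z : TDom 4 N' => Z.1) (act b) X.1‖ := by rw [hE b hb]
    _ ≤ Real.exp 1 * 9 * 64 * K₀ 64 8 ^ 2 * (c.C3act * c.ε₁) * Ex := key
    _ ≤ c.A₂ * (c.C3act * c.ε₁) * Ex := mul_le_mul_of_nonneg_right (mul_le_mul_of_nonneg_right hA₂ hAct) hEx0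
    _ = c.A₂ * c.C3act * c.ε₁ * Ex := by ring

end Summit.QuantumFields.BalabanUV.T4Continuum.Spine.NE5.TwoRunTorusParam

end
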